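import Mathlib
import Literature.NumberTheory.Transcendental.PeriodConjecture
import Literature.NumberTheory.Transcendental.KZCalculusProofs
import Summits.KontsevichZagierPeriods.KontsevichZagierPeriods.Theorems.InverseLandauTateLiftingGenLifting

/-!
# `TateLifting`, line `Sketch`, stub `stub_forms` — the three forms of the crux

Crux stmt-KontsevichZagierPeriods-9129
(`Summit.KontsevichZagierPeriods.KontsevichZagierPeriods.Theses.InverseLandau.TateLifting`:
`ker eval ⊆ relations ⊔ closure T`, `T` the Tate fibres) of route InverseLandau.

* (i) `kzKernelConjecture_iff_tateFamilyKernel_and_tateLifting` — within the route the crux IS the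
  kernel form `KZKernelConjecture` of Kontsevich–Zagier's Conjecture 1 modulo the other crux
  `TateFamilyKernel` (`→`: Tate fibres evaluate to `0` and the empty fibre combination;
  `←`: verbatim the route's deciding theorem `closes`);
* (ii) `tateLifting_iff_pair` — the PAIR NORMAL FORM: `TateLifting` iff any two representations of
  the same number differ by an element of `relations ⊔ closure T` (every formal combination is
  `≡ [r] − [r′]` modulo moves, `KZ.exists_integralRep_sub_holds`, and soundness
  `KZ.relations_le_ker_eval_holds`);
* (iii) `tateLifting_iff_pair_isRational` — the same with both endpoints of KZ's literal rational
  shape (`KZ.exists_isRational_equivalent_holds`, `KZ.Equivalent.value_eq_holds`);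
* `tateLifting_forms` — the registered conjunction of (i)–(iii).

(ii) and (iii) are proved once for an arbitrary summand `H : AddSubgroup KZ.FormalRep` in place of
`closure T` (`kernel_le_sup_iff_pair`, `pair_iff_pair_isRational`) and instantiated. Nothing here
asserts `KZKernelConjecture`, `TateLifting` or `TateFamilyKernel`: all three are open and only appear
inside `↔`.
-/

noncomputable section

namespace Summit.KontsevichZagierPeriods.InverseLandau

open Literature.NumberTheory.Transcendental
open Summit.KontsevichZagierPeriods.KontsevichZagierPeriods.Theses.InverseLandau
  (TateLifting TateFamilyKernel)

/-- **Kernel form versus pair form, relative to a summand.** For any subgroup `H` of the formal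
group: every formal combination of value `0` lies in `relations ⊔ H` iff for any two integral
representations of the same number `[r] − [r′] ∈ relations ⊔ H`. `→`: take `c = [r] − [r′]`;
`←`: `c ≡ [r] − [r′]` modulo moves (`KZ.exists_integralRep_sub_holds`) and soundness
(`KZ.relations_le_ker_eval_holds`) gives `value r = value r′`. [cite: KontsevichZagier2001, §1.2] -/
theorem kernel_le_sup_iff_pair (H : AddSubgroup KZ.FormalRep) :
    (∀ c : KZ.FormalRep, KZ.eval c = 0 → c ∈ KZ.relations ⊔ H) ↔
    ∀ (n m : ℕ) (r : KZ.IntegralRep n) (r' : KZ.IntegralRep m), r.value = r'.value →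
      KZ.of r - KZ.of r' ∈ KZ.relations ⊔ H := by
  constructor
  · intro h n m r r' hv
    apply h
    rw [map_sub, KZ.eval_of, KZ.eval_of, hv, sub_self]
  · intro h c hc
    obtain ⟨n, m, r, r', hrel⟩ := KZ.exists_integralRep_sub_holds c
    have hker : KZ.eval (c - (KZ.of r - KZ.of r')) = 0 := KZ.relations_le_ker_eval_holds hrel
    rw [map_sub, hc, zero_sub, neg_eq_zero, map_sub, KZ.eval_of, KZ.eval_of, sub_eq_zero] at hker
    have hsum := add_mem (AddSubgroup.mem_sup_left (T := H) hrel) (h n m r r' hker)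
    rwa [sub_add_cancel] at hsum

/-- **Algebraic versus rational endpoints, relative to a summand.** The pair form for all
representations (with `ℚ`-semialgebraic data) is equivalent to the pair form for representations of
KZ's literal rational shape (`KZ.IntegralRep.IsRational`): every representation is equivalent by the
moves to a rational-shape one (`KZ.exists_isRational_equivalent_holds`) and equivalent representations
have equal values (`KZ.Equivalent.value_eq_holds`). [cite: KontsevichZagier2001, §1.2] -/
theorem pair_iff_pair_isRational (H : AddSubgroup KZ.FormalRep) :
    (∀ (n m : ℕ) (r : KZ.IntegralRep n) (r' : KZ.IntegralRep m), r.value = r'.value →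
      KZ.of r - KZ.of r' ∈ KZ.relations ⊔ H) ↔
    ∀ (n m : ℕ) (r : KZ.IntegralRep n) (r' : KZ.IntegralRep m),
      r.IsRational → r'.IsRational → r.value = r'.value →
      KZ.of r - KZ.of r' ∈ KZ.relations ⊔ H := by
  constructor
  · intro h n m r r' _ _ hv
    exact h n m r r' hv
  · intro h n m r r' hv
    obtain ⟨N, R, hR, hrR⟩ := KZ.exists_isRational_equivalent_holds r
    obtain ⟨N', R', hR', hrR'⟩ := KZ.exists_isRational_equivalent_holds r'
    have hvR : R.value = R'.value := by
      rw [← KZ.Equivalent.value_eq_holds hrR, ← KZ.Equivalent.value_eq_holds hrR', hv]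
    have hsum := sub_mem (add_mem (AddSubgroup.mem_sup_left (T := H) hrR) (h N N' R R' hR hR' hvR))
      (AddSubgroup.mem_sup_left (T := H) hrR')
    have hid : KZ.of r - KZ.of R + (KZ.of R - KZ.of R') - (KZ.of r' - KZ.of R') =
        KZ.of r - KZ.of r' := by abel
    rwa [hid] at hsum

/-- **(i) The crux is the summit modulo the other crux**: `KZKernelConjecture ↔
TateFamilyKernel ∧ TateLifting`. `→`: a Tate fibre `[(0,1)ⁿ, P/Q(·,ϖ₀)]` evaluates to the fibre
integral at `ϖ₀ ∈ (0,ε)`, which vanishes, so the kernel form puts it in `relations`; and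
`TateLifting` follows with the empty fibre combination (`TateLifting_of_kzKernelConjecture`).
`←`: the route's deciding theorem — `closure T ≤ relations` by `TateFamilyKernel`, hence
`relations ⊔ closure T ≤ relations`. [cite: KontsevichZagier2001, §1.2] -/
theorem kzKernelConjecture_iff_tateFamilyKernel_and_tateLifting :
    KZKernelConjecture ↔ (TateFamilyKernel ∧ TateLifting) := by
  constructor
  · intro hK
    refine ⟨?_, TateLifting_of_kzKernelConjecture hK⟩
    intro n P Q ε _ _ _ hV ϖ₀ _ hϖ₀ r hdom heq
    apply hK
    rw [KZ.eval_of]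
    show ∫ x in r.domain, r.integrand x = 0
    rw [MeasureTheory.setIntegral_congr_fun (KZ.IntegralRep.measurableSet_domain_holds r) heq, hdom]
    exact hV ϖ₀ hϖ₀
  · rintro ⟨hK, hL⟩ c hc
    refine sup_le le_rfl ((AddSubgroup.closure_le _).mpr ?_) (hL c hc)
    rintro d ⟨n, P, Q, ε, ϖ₀, r, hε, hT, hA, hV, halg, hϖ₀, hdom, heq, rfl⟩
    exact hK n P Q ε hε hT hA hV ϖ₀ halg hϖ₀ r hdom heq

/-- **(ii) Pair normal form of the crux**: `TateLifting` iff any two integral representations of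
the same real number differ, in the formal group, by an element of `relations ⊔ closure T`
(`T` the Tate fibres) — `kernel_le_sup_iff_pair` at `H := closure T`.
[cite: KontsevichZagier2001, §1.2] -/
theorem tateLifting_iff_pair :
    TateLifting ↔ ∀ (n m : ℕ) (r : KZ.IntegralRep n) (r' : KZ.IntegralRep m), r.value = r'.value →
      KZ.of r - KZ.of r' ∈ KZ.relations ⊔ AddSubgroup.closure {d : KZ.FormalRep |
        ∃ (n : ℕ) (P Q : MvPolynomial (Fin (n + 1)) ℚ) (ε ϖ₀ : ℝ) (r : KZ.IntegralRep n), 0 < ε ∧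
        (∃ c₀ : ℚ, c₀ ≠ 0 ∧ ∀ z : Fin n → ℝ,
          MvPolynomial.aeval (Fin.snoc z (0 : ℝ) : Fin (n + 1) → ℝ) Q = (c₀ : ℝ)) ∧
        (∀ (z : Fin n → ℝ) (ϖ : ℝ), (∀ i, z i ∈ Set.Icc (0 : ℝ) 1) → ϖ ∈ Set.Ioo 0 ε →
          MvPolynomial.aeval (Fin.snoc z ϖ : Fin (n + 1) → ℝ) Q ≠ 0) ∧
        (∀ ϖ ∈ Set.Ioo (0 : ℝ) ε, ∫ z in Set.pi Set.univ (fun _ : Fin n => Set.Ioo (0 : ℝ) 1),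
          MvPolynomial.aeval (Fin.snoc z ϖ : Fin (n + 1) → ℝ) P /
            MvPolynomial.aeval (Fin.snoc z ϖ : Fin (n + 1) → ℝ) Q = 0) ∧
        IsAlgebraic ℚ ϖ₀ ∧ ϖ₀ ∈ Set.Ioo 0 ε ∧
        r.domain = Set.pi Set.univ (fun _ : Fin n => Set.Ioo (0 : ℝ) 1) ∧
        Set.EqOn r.integrand (fun z => MvPolynomial.aeval (Fin.snoc z ϖ₀ : Fin (n + 1) → ℝ) P /
          MvPolynomial.aeval (Fin.snoc z ϖ₀ : Fin (n + 1) → ℝ) Q) r.domain ∧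
        d = KZ.of r} :=
  kernel_le_sup_iff_pair _

/-- **(iii) Pair normal form with rational endpoints**: `TateLifting` iff any two integral
representations of KZ's literal rational shape with the same value differ by an element of
`relations ⊔ closure T` — (ii) followed by `pair_iff_pair_isRational` at `H := closure T`.
[cite: KontsevichZagier2001, §1.2] -/
theorem tateLifting_iff_pair_isRational :
    TateLifting ↔ ∀ (n m : ℕ) (r : KZ.IntegralRep n) (r' : KZ.IntegralRep m),
      r.IsRational → r'.IsRational → r.value = r'.value →
      KZ.of r - KZ.of r' ∈ KZ.relations ⊔ AddSubgroup.closure {d : KZ.FormalRep |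
        ∃ (n : ℕ) (P Q : MvPolynomial (Fin (n + 1)) ℚ) (ε ϖ₀ : ℝ) (r : KZ.IntegralRep n), 0 < ε ∧
        (∃ c₀ : ℚ, c₀ ≠ 0 ∧ ∀ z : Fin n → ℝ,
          MvPolynomial.aeval (Fin.snoc z (0 : ℝ) : Fin (n + 1) → ℝ) Q = (c₀ : ℝ)) ∧
        (∀ (z : Fin n → ℝ) (ϖ : ℝ), (∀ i, z i ∈ Set.Icc (0 : ℝ) 1) → ϖ ∈ Set.Ioo 0 ε →
          MvPolynomial.aeval (Fin.snoc z ϖ : Fin (n + 1) → ℝ) Q ≠ 0) ∧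
        (∀ ϖ ∈ Set.Ioo (0 : ℝ) ε, ∫ z in Set.pi Set.univ (fun _ : Fin n => Set.Ioo (0 : ℝ) 1),
          MvPolynomial.aeval (Fin.snoc z ϖ : Fin (n + 1) → ℝ) P /
            MvPolynomial.aeval (Fin.snoc z ϖ : Fin (n + 1) → ℝ) Q = 0) ∧
        IsAlgebraic ℚ ϖ₀ ∧ ϖ₀ ∈ Set.Ioo 0 ε ∧
        r.domain = Set.pi Set.univ (fun _ : Fin n => Set.Ioo (0 : ℝ) 1) ∧
        Set.EqOn r.integrand (fun z => MvPolynomial.aeval (Fin.snoc z ϖ₀ : Fin (n + 1) → ℝ) P /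
          MvPolynomial.aeval (Fin.snoc z ϖ₀ : Fin (n + 1) → ℝ) Q) r.domain ∧
        d = KZ.of r} :=
  (kernel_le_sup_iff_pair _).trans (pair_iff_pair_isRational _)

/-- **Forms of the crux `TateLifting`** (registered stub `stub_forms` of line `Sketch`): the
conjunction of (i) `KZKernelConjecture ↔ TateFamilyKernel ∧ TateLifting`, (ii) the pair normal
form and (iii) the pair normal form with rational endpoints, assembled from
`kzKernelConjecture_iff_tateFamilyKernel_and_tateLifting`, `tateLifting_iff_pair`,
`tateLifting_iff_pair_isRational`. [cite: KontsevichZagier2001, §1.2] -/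
theorem tateLifting_forms :
    (KZKernelConjecture ↔ (TateFamilyKernel ∧ TateLifting)) ∧
    (TateLifting ↔ ∀ (n m : ℕ) (r : KZ.IntegralRep n) (r' : KZ.IntegralRep m), r.value = r'.value →
      KZ.of r - KZ.of r' ∈ KZ.relations ⊔ AddSubgroup.closure {d : KZ.FormalRep |
        ∃ (n : ℕ) (P Q : MvPolynomial (Fin (n + 1)) ℚ) (ε ϖ₀ : ℝ) (r : KZ.IntegralRep n), 0 < ε ∧
        (∃ c₀ : ℚ, c₀ ≠ 0 ∧ ∀ z : Fin n → ℝ,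
          MvPolynomial.aeval (Fin.snoc z (0 : ℝ) : Fin (n + 1) → ℝ) Q = (c₀ : ℝ)) ∧
        (∀ (z : Fin n → ℝ) (ϖ : ℝ), (∀ i, z i ∈ Set.Icc (0 : ℝ) 1) → ϖ ∈ Set.Ioo 0 ε →
          MvPolynomial.aeval (Fin.snoc z ϖ : Fin (n + 1) → ℝ) Q ≠ 0) ∧
        (∀ ϖ ∈ Set.Ioo (0 : ℝ) ε, ∫ z in Set.pi Set.univ (fun _ : Fin n => Set.Ioo (0 : ℝ) 1),
          MvPolynomial.aeval (Fin.snoc z ϖ : Fin (n + 1) → ℝ) P /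
            MvPolynomial.aeval (Fin.snoc z ϖ : Fin (n + 1) → ℝ) Q = 0) ∧
        IsAlgebraic ℚ ϖ₀ ∧ ϖ₀ ∈ Set.Ioo 0 ε ∧
        r.domain = Set.pi Set.univ (fun _ : Fin n => Set.Ioo (0 : ℝ) 1) ∧
        Set.EqOn r.integrand (fun z => MvPolynomial.aeval (Fin.snoc z ϖ₀ : Fin (n + 1) → ℝ) P /
          MvPolynomial.aeval (Fin.snoc z ϖ₀ : Fin (n + 1) → ℝ) Q) r.domain ∧
        d = KZ.of r}) ∧
    (TateLifting ↔ ∀ (n m : ℕ) (r : KZ.IntegralRep n) (r' : KZ.IntegralRep m),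
      r.IsRational → r'.IsRational → r.value = r'.value →
      KZ.of r - KZ.of r' ∈ KZ.relations ⊔ AddSubgroup.closure {d : KZ.FormalRep |
        ∃ (n : ℕ) (P Q : MvPolynomial (Fin (n + 1)) ℚ) (ε ϖ₀ : ℝ) (r : KZ.IntegralRep n), 0 < ε ∧
        (∃ c₀ : ℚ, c₀ ≠ 0 ∧ ∀ z : Fin n → ℝ,
          MvPolynomial.aeval (Fin.snoc z (0 : ℝ) : Fin (n + 1) → ℝ) Q = (c₀ : ℝ)) ∧
        (∀ (z : Fin n → ℝ) (ϖ : ℝ), (∀ i, z i ∈ Set.Icc (0 : ℝ) 1) → ϖ ∈ Set.Ioo 0 ε →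
          MvPolynomial.aeval (Fin.snoc z ϖ : Fin (n + 1) → ℝ) Q ≠ 0) ∧
        (∀ ϖ ∈ Set.Ioo (0 : ℝ) ε, ∫ z in Set.pi Set.univ (fun _ : Fin n => Set.Ioo (0 : ℝ) 1),
          MvPolynomial.aeval (Fin.snoc z ϖ : Fin (n + 1) → ℝ) P /
            MvPolynomial.aeval (Fin.snoc z ϖ : Fin (n + 1) → ℝ) Q = 0) ∧
        IsAlgebraic ℚ ϖ₀ ∧ ϖ₀ ∈ Set.Ioo 0 ε ∧
        r.domain = Set.pi Set.univ (fun _ : Fin n => Set.Ioo (0 : ℝ) 1) ∧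
        Set.EqOn r.integrand (fun z => MvPolynomial.aeval (Fin.snoc z ϖ₀ : Fin (n + 1) → ℝ) P /
          MvPolynomial.aeval (Fin.snoc z ϖ₀ : Fin (n + 1) → ℝ) Q) r.domain ∧
        d = KZ.of r}) :=
  ⟨kzKernelConjecture_iff_tateFamilyKernel_and_tateLifting, tateLifting_iff_pair,
    tateLifting_iff_pair_isRational⟩

end Summit.KontsevichZagierPeriods.InverseLandau

end
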